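import Literature.Analysis.FluidPDE.PassiveScalarEnergySlice
import Literature.Analysis.FunctionSpaces.TorusSobolevNormProofs
import Literature.Analysis.FunctionSpaces.TorusInverseLaplacian
import Literature.Analysis.FunctionSpaces.TorusInverseLaplacianL2
import Literature.Analysis.FunctionSpaces.SpaceTimeWeakCompactness
import HarnessLib

/-!
# The spectral Poincaré inequality for real scalars on the flat torus

Analysis/FluidPDE proof-support file (everything proved). For a real scalar `θ ∈ L²(T^d)` the
spectral squared gradient norm `Torus.eScalarGradNormSq θ = 4π² ∑ₖ |k|² |θ̂(k)|²` (the `Ḣ¹`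
seminorm of `PassiveScalar`, meaningful for every `L²` — indeed every integrable — scalar)
dominates `4π²` times the variance:

* `tsum_enorm_sq_mFourierCoeff_ne_zero_le_eScalarGradNormSq` —
  `4π² ∑_{k ≠ 0} |θ̂(k)|² ≤ eScalarGradNormSq θ` (`|k|² ≥ 1` off the zero mode);
* `ofReal_scalarVariance_le_eScalarGradNormSq` — for `θ ∈ L²`,
  `ofReal (4π² Var θ) ≤ eScalarGradNormSq θ`, `Var θ = ∫θ² - (∫θ)²` (Parseval and
  `θ̂(0) = ∫ θ`);
* `scalarVariance_le_toReal_eScalarGradNormSq` — the real form `4π² Var θ ≤ ‖∇θ‖²` when the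
  right-hand side is finite.

This is the Poincaré–Wirtinger inequality on `T^d = (ℝ/ℤ)^d` with its sharp constant `4π²`
(first nonzero eigenvalue of `-Δ`), in the weak (spectral) class used by the passive-scalar files
(Grafakos 2014, Prop. 3.2.7 (3) for Parseval; the inequality itself is folklore). It is the input
making "bounded dissipation ⟹ bounded variance" and mean-conservation arguments honest for weak
solutions (e.g. the sourced scalar of the age-decoupling argument).
-/

noncomputable section

open _root_.MeasureTheory _root_.Set _root_.Filter _root_.UnitAddTorus
open scoped ENNReal NNReal

namespace Literature.Analysis.FluidPDE

namespace Torus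

variable {d : Type*} [Fintype d]

/-- **Off the zero mode the spectral gradient weight is at least `4π²`**:
`4π² ∑_{k ≠ 0} |θ̂(k)|² ≤ eScalarGradNormSq θ` for every real scalar `θ` (termwise
`|k|² ≥ 1` for `k ≠ 0`). [folklore] -/
theorem tsum_enorm_sq_mFourierCoeff_ne_zero_le_eScalarGradNormSq (θ : UnitAddTorus d → ℝ) :
    ENNReal.ofReal (4 * Real.pi ^ 2) *
        ∑' k : d → ℤ, (if k = 0 then 0 else ‖mFourierCoeff (fun x => (θ x : ℂ)) k‖ₑ ^ 2) ≤
      eScalarGradNormSq θ := by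
  classical
  rw [eScalarGradNormSq_eq_tsum]
  gcongr with k
  by_cases hk : k = 0
  · simp [hk]
  · rw [if_neg hk]
    have h1 : (1 : ℝ≥0∞) ≤ ENNReal.ofReal (FunctionSpaces.Torus.freqNormSq k) := by
      rw [← ENNReal.ofReal_one]
      exact ENNReal.ofReal_le_ofReal (FunctionSpaces.Torus.one_le_freqNormSq_of_ne_zero hk)
    calc ‖mFourierCoeff (fun x => (θ x : ℂ)) k‖ₑ ^ 2
        = 1 * ‖mFourierCoeff (fun x => (θ x : ℂ)) k‖ₑ ^ 2 := (one_mul _).symm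
      _ ≤ ENNReal.ofReal (FunctionSpaces.Torus.freqNormSq k) * ‖mFourierCoeff (fun x => (θ x : ℂ)) k‖ₑ ^ 2 := by
          gcongr

/-- **Parseval off the zero mode**: for `θ ∈ L²(T^d)`,
`∑_{k ≠ 0} |θ̂(k)|² + |∫ θ|² = ∫ θ²` in `[0, ∞]`, i.e.
`∑_{k ≠ 0} |θ̂(k)|² + ofReal ((∫θ)²) = ofReal (∫ θ²)` (`θ̂(0) = ∫ θ`;
Grafakos 2014, Prop. 3.2.7 (3)). [cite: Grafakos2014, Prop. 3.2.7 (3)] -/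
theorem tsum_enorm_sq_mFourierCoeff_ne_zero_add (θ : UnitAddTorus d → ℝ) (hθ : MemLp θ 2 volume) :
    (∑' k : d → ℤ, (if k = 0 then 0 else ‖mFourierCoeff (fun x => (θ x : ℂ)) k‖ₑ ^ 2)) +
        ENNReal.ofReal ((∫ x, θ x) ^ 2) =
      ENNReal.ofReal (∫ x, θ x ^ 2) := by
  classical
  have hθc : MemLp (fun x => (θ x : ℂ)) 2 volume := hθ.ofReal
  have hpar := FunctionSpaces.Torus.tsum_enorm_sq_mFourierCoeff_eq_eLpNorm_sq hθc
  -- the zero mode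
  have h0 : ‖mFourierCoeff (fun x => (θ x : ℂ)) 0‖ₑ ^ 2 = ENNReal.ofReal ((∫ x, θ x) ^ 2) := by
    rw [FunctionSpaces.Torus.mFourierCoeff_zero_eq_integral, integral_complex_ofReal, ← ofReal_norm,
      ← ENNReal.ofReal_pow (norm_nonneg _), Complex.norm_real, Real.norm_eq_abs, sq_abs]
  -- split the full Parseval sum at `k = 0`
  have hsplit : ∑' k : d → ℤ, ‖mFourierCoeff (fun x => (θ x : ℂ)) k‖ₑ ^ 2 =
      (∑' k : d → ℤ, (if k = 0 then 0 else ‖mFourierCoeff (fun x => (θ x : ℂ)) k‖ₑ ^ 2)) +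
        ‖mFourierCoeff (fun x => (θ x : ℂ)) 0‖ₑ ^ 2 := by
    rw [ENNReal.tsum_eq_add_tsum_ite (0 : d → ℤ), add_comm]
    congr 1
    refine tsum_congr fun k => ?_
    by_cases hk : k = 0 <;> simp [hk]
  -- `eLpNorm (↑θ) 2 ^ 2 = ofReal (∫ θ²)`
  have hL2 : eLpNorm (fun x => (θ x : ℂ)) 2 volume ^ 2 = ENNReal.ofReal (∫ x, θ x ^ 2) := by
    rw [FunctionSpaces.eLpNorm_two_pow_two_eq_lintegral]
    have e1 : ∫⁻ x, ‖(θ x : ℂ)‖ₑ ^ 2 = ∫⁻ x, ‖θ x‖ₑ ^ 2 := lintegral_congr fun x => by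
      rw [← ofReal_norm, Complex.norm_real, ofReal_norm]
    rw [e1, ← FunctionSpaces.eLpNorm_two_pow_two_eq_lintegral]
    have h2 := hθ.eLpNorm_eq_integral_rpow_norm two_ne_zero ENNReal.ofNat_ne_top
    rw [h2, ← ENNReal.ofReal_pow (by positivity)]
    congr 1
    rw [ENNReal.toReal_ofNat, ← Real.rpow_natCast,
      ← Real.rpow_mul (integral_nonneg fun x => by positivity)]
    norm_num
  rw [← h0, ← hsplit, hpar, hL2]

/-- **Spectral Poincaré inequality for real scalars** (Poincaré–Wirtinger on `T^d` with the
sharp constant `4π²`, in the weak class): for `θ ∈ L²(T^d)`,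
`ofReal (4π² (∫θ² - (∫θ)²)) ≤ eScalarGradNormSq θ`. [folklore] -/
theorem ofReal_scalarVariance_le_eScalarGradNormSq {θ : UnitAddTorus d → ℝ} (hθ : MemLp θ 2 volume) :
    ENNReal.ofReal (4 * Real.pi ^ 2 * ((∫ x, θ x ^ 2) - (∫ x, θ x) ^ 2)) ≤ eScalarGradNormSq θ := by
  classical
  refine le_trans ?_ (tsum_enorm_sq_mFourierCoeff_ne_zero_le_eScalarGradNormSq θ)
  have hadd := tsum_enorm_sq_mFourierCoeff_ne_zero_add θ hθ
  set X : ℝ≥0∞ := ∑' k : d → ℤ, (if k = 0 then 0 else ‖mFourierCoeff (fun x => (θ x : ℂ)) k‖ₑ ^ 2) with hX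
  have hXeq : X = ENNReal.ofReal (∫ x, θ x ^ 2) - ENNReal.ofReal ((∫ x, θ x) ^ 2) :=
    (ENNReal.eq_sub_of_add_eq ENNReal.ofReal_ne_top hadd)
  rw [ENNReal.ofReal_mul (by positivity), ENNReal.ofReal_sub _ (sq_nonneg _), hXeq]

/-- **Spectral Poincaré inequality, real form**: for `θ ∈ L²(T^d)` with `eScalarGradNormSq θ < ∞`,
`4π² (∫θ² - (∫θ)²) ≤ (eScalarGradNormSq θ).toReal`. [folklore] -/
theorem scalarVariance_le_toReal_eScalarGradNormSq {θ : UnitAddTorus d → ℝ} (hθ : MemLp θ 2 volume)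
    (hfin : eScalarGradNormSq θ ≠ ⊤) :
    4 * Real.pi ^ 2 * ((∫ x, θ x ^ 2) - (∫ x, θ x) ^ 2) ≤ (eScalarGradNormSq θ).toReal :=
  (ENNReal.ofReal_le_iff_le_toReal hfin).1 (ofReal_scalarVariance_le_eScalarGradNormSq hθ)

end Torus

end Literature.Analysis.FluidPDE

end
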